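import Summits.BirchSwinnertonDyer.BirchSwinnertonDyer.Theorems.ManinLocalTwoThreeOddTwistRootFormTransport
import Summits.BirchSwinnertonDyer.BirchSwinnertonDyer.Theorems.ManinLocalTwoThreeBracketSturm
import Summits.BirchSwinnertonDyer.Rank1Residual.ManinAdditive.TwistOrbitManinTransportProof
import Literature.NumberTheory.EllipticCurves.CuspFormTwist
import Literature.NumberTheory.EllipticCurves.RootNumberTwistProofs
import HarnessLib

/-!
# THE SAME-LEVEL ALIGNED ODD-TWIST TRANSPORT of `|c| = 1` between two ADDITIVE fibres — THEOREM 68.A with an aligned root CURVE instead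
# of a semistable one, and with the root FORM built inside the datum

Cell bsd-f2-manin, route `ManinLocalTwoThree` (cruxes C2 `ManinOddAtFour` stmt-BirchSwinnertonDyer-22967 / C3 `ManinPrimeToThreeAtNine`
stmt-BirchSwinnertonDyer-22968), prover seat p3 gen 27.  The ENGINE behind `…ManinConstantOneThirtyFive` (class `135b = 135a ⊗ χ₋₃`), made
level-free for the cell's C3 "twist-minimal" census (same-level ALIGNED `χ₋₃`-pairs of optimal classes with `27 ∣ N` or `9 ∥ N`, one member with a
weight-2 Bracket–Sturm presentation, the other with none: `189a → 189d`, `216a → 216d`, `216b → 216c`, `297b → 297c`, `297d → 297a`, `99a → 99c`,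
`153a → 153d`, `270c → 270a`, `405c → 405d`, `405f → 405e`, …; kernel census `scripts/`, Cremona `allcurves`).

* §1 `abs_maninConstant_eq_one_of_rootForm_alignedTwist` — `q` an odd prime, `χ = (·/q) ⊗ ℂ`; ROOT CURVE `A/ℚ` globally minimal (ANY reduction
  at `q`) with a Néron pair `L_A` and a ROOT FORM `f₀ ∈ S₂(Γ₀(M))` squeezed into it, `Λ(f₀) ⊆ Λ(L_A)`; TARGET `W/ℚ` globally minimal with an
  `X₀(N)`-datum `D` (`M ∣ N`, `q² ∣ N`), `aₙ(D.f) = χ(n)·aₙ(f₀)`, lattice clause; and an ALIGNED minimal model of the twist,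
  `u • (A ⊗ ℚ(√q*)) = C` globally minimal with `Δ(C) = (q*)⁶·Δ(A)`.  Then `|c(D)| = 1`.  Chain: `Λ(L_C) = g(χ)⁻¹·Λ(L_A)` for any Néron pair `L_C`
  of `C` (`neronLattice_mem_iff_of_twist_pStar`, `r = 1` — Pal 2012 Lemma 3.1, NO semistability, unlike Stevens (5.2) used by
  `OddTwistRootForm.abs_maninConstant_eq_one_of_rootForm_oddTwist`); `Λ(D.f) ⊆ Λ(L_C)` by the `Γ₀`-twisting theorem
  (`OddTwistRootForm.periodLattice_le_of_rootForm_charTwist`, Stevens (5.4)); p3's Néron squeeze with `C`.  (When `Δ(C) = (q*)⁶Δ(A)/q¹²` instead —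
  the twist DOWN — the same chain only gives `c ∣ q`; transport always runs from the fibre with the smaller `|Δ_min|`.)
* §2 `eq_charTwist_charTwist_of_cuspCoeff_eq_zero` — THE DATUM-INTERNAL ROOT FORM: if `aₙ(g) = 0` for all `n < B` with `q ∣ n`, `B` beyond the
  weight-2 Sturm bound of `Γ₀(N)` (`q² ∣ N`), then `g = ((g)^χ)^χ` in `S₂(Γ₀(N))`, so `f₀ := g^χ ∈ S₂(Γ₀(N))` is a root form for `g` with
  `aₙ(g) = χ(n)·aₙ(f₀)` for ALL `n` (`cuspCoeff_eq_chi_mul_charTwist`) — additivity at `q` read off finitely many coefficients, no reduction theory.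
* §3 `abs_maninConstant_eq_one_of_alignedTwist_of_squeeze` — §1 + §2 packaged for the level files: the root-form squeeze is asked only for
  `f₀ = (D.f)^χ`, i.e. in the shape `periodLatticeLe_<class>_of_coeff` that the Bracket–Sturm files export.

HONEST FRAMING.  Unconditional (standard axioms); an ENGINE — it proves `|c| = 1` on an aligned same-level twist row only given the analytic squeeze
of the root row; nothing here proves C2, C3 (∀ N), Manin's conjecture or BSD; items 22967/22968 stay OPEN.  No definition, no named fact, no sorry.
[cite: Pal2012, Lemma 3.1] [cite: Stevens1989, Lemma (5.4) p. 97] [cite: Shimura1971, Prop. 3.64] [cite: Sturm1987, Thm. 1]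
[cite: AgasheRibetStein2006, §§1–2] [cite: SilvermanATAEC1994, Cor. IV.9.1]
-/

set_option autoImplicit false
-- lint-debt: the directory name repeats the summit name (sibling precedent `ManinLocalTwoThreeOddTwistRootFormTransport.lean`)
set_option linter.dupNamespace false

noncomputable section

open scoped MatrixGroups ModularForm
open ModularForm CongruenceSubgroup WeierstrassCurve
open Literature.NumberTheory.EllipticCurves Literature.NumberTheory.EllipticCurves.ModularForms
open Summit.BirchSwinnertonDyer.Rank1Residual.ManinAdditive (neronLattice_mem_iff_of_twist_pStar)

namespace Summit.BirchSwinnertonDyer.BirchSwinnertonDyer.Theorems.ManinLocalTwoThree.SameLevelTwistRootForm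

/-! ## §1 The transport from a root form squeezed into an ALIGNED root curve -/

/-- **`|c| = 1` ON AN ALIGNED ODD-TWIST ROW FROM A SQUEEZED ROOT FORM** (any reduction of the root curve at `q`).  See the module docstring, §1.
[cite: Pal2012, Lemma 3.1] [cite: Stevens1989, Lemma (5.4) p. 97] [cite: AgasheRibetStein2006, §§1–2] [cite: SilvermanATAEC1994, Cor. IV.9.1] -/
theorem abs_maninConstant_eq_one_of_rootForm_alignedTwist {q : ℕ} [Fact q.Prime] (hq2 : q ≠ 2)
    {M : ℕ} [NeZero M] (f₀ : CuspForm (Gamma0 M) 2)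
    (A : WeierstrassCurve ℚ) [A.IsElliptic] (LA : PeriodPair) (hLA : IsNeronLatticeOf (A.baseChange ℂ) LA)
    (hS0 : ∀ z ∈ periodLattice f₀, z ∈ LA.lattice)
    (C : WeierstrassCurve ℚ) [C.IsElliptic] [C.IsGloballyMinimal] (u : VariableChange ℚ)
    (hu : u • A.quadraticTwist (((-1 : ℤ) ^ (q / 2) * q : ℤ) : ℚ) = C)
    (hΔ : C.Δ = ((((-1 : ℤ) ^ (q / 2) * q : ℤ)) : ℚ) ^ 6 * A.Δ)
    (W : WeierstrassCurve ℚ) [W.IsElliptic] [W.IsGloballyMinimal] {N : ℕ} [NeZero N]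
    (D : ModularParametrizationData W N) (hMN : M ∣ N) (hqN : q ^ 2 ∣ N)
    (hf : ∀ n : ℕ, cuspCoeff D.f n = (quadraticChar (ZMod q)).ringHomComp (Int.castRingHom ℂ) n * cuspCoeff f₀ n)
    (hopt : ∀ z ∈ D.L.lattice, ∃ w ∈ periodLattice D.f, z = D.c * w) :
    |D.maninConstant| = 1 := by
  haveI : NeZero q := ⟨(Fact.out : q.Prime).ne_zero⟩
  haveI : (C.baseChange ℂ).IsElliptic := by rw [WeierstrassCurve.baseChange]; infer_instance
  obtain ⟨LC, hC2, hC3⟩ := (C.baseChange ℂ).exists_periodPair_of_isElliptic'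
  have hLC : IsNeronLatticeOf (C.baseChange ℂ) LC := ⟨hC2, hC3⟩
  have hΔ1 : (1 : ℚ) ^ 12 * C.Δ = ((((-1 : ℤ) ^ (q / 2) * q : ℤ)) : ℚ) ^ 6 * A.Δ := by rw [one_pow, one_mul]; exact hΔ
  -- the aligned Néron-lattice identity `Λ(L_C) = g(χ)⁻¹ Λ(L_A)` (Pal 2012 Lemma 3.1, `r = 1`)
  have hLC' : ∀ z : ℂ, z ∈ LC.lattice ↔
      gaussSum ((quadraticChar (ZMod q)).ringHomComp (Int.castRingHom ℂ)) (ZMod.stdAddChar (N := q)) * z ∈ LA.lattice := fun z ↦ by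
    simpa using neronLattice_mem_iff_of_twist_pStar hq2 u hu hΔ1 hLA hLC z
  -- Γ₀-twisting (Stevens (5.4)): `Λ(D.f) ⊆ Λ(L_C)`; then the Néron squeeze with the globally minimal `C`
  have hS2 : ∀ z ∈ periodLattice D.f, z ∈ LC.lattice :=
    OddTwistRootForm.periodLattice_le_of_rootForm_charTwist hMN hqN (isQuadratic_quadraticChar_ringHomComp q)
      (isPrimitive_quadraticChar_ringHomComp q hq2) f₀ LA hS0 LC hLC' D.f hf
  exact NeronSqueeze.abs_maninConstant_eq_one_of_periodLattice_le C LC hLC W D hS2 hopt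

/-! ## §2 The datum-internal root form: `g = ((g)^χ)^χ` from finitely many vanishing coefficients -/

/-- **`g = (g^χ)^χ` in `S₂(Γ₀(N))` when `aₙ(g) = 0` for `q ∣ n`, `n < B`, `B` beyond the weight-2 Sturm bound** (`q` odd, `q² ∣ N`, `χ = (·/q) ⊗ ℂ`):
the coefficients of `g − (g^χ)^χ` are `aₙ(g)·(1 − χ(n)²)`, zero below `B`, so Sturm applies. [cite: Sturm1987, Thm. 1] [cite: Shimura1971, Prop. 3.64] -/
theorem eq_charTwist_charTwist_of_cuspCoeff_eq_zero {q : ℕ} [Fact q.Prime] (hq2 : q ≠ 2) {N : ℕ} [NeZero N] (hqN : q ^ 2 ∣ N)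
    (g : CuspForm (Gamma0 N) 2) {B : ℕ} (hB : ((2 : ℤ) * gamma0Index N).toNat / 12 < B)
    (hzero : ∀ n < B, q ∣ n → cuspCoeff g n = 0) :
    g = charTwist N (dvd_refl N) hqN (isQuadratic_quadraticChar_ringHomComp q)
      (charTwist N (dvd_refl N) hqN (isQuadratic_quadraticChar_ringHomComp q) g) := by
  have hqP : q.Prime := Fact.out
  have hprim := isPrimitive_quadraticChar_ringHomComp q hq2
  set g2 := charTwist N (dvd_refl N) hqN (isQuadratic_quadraticChar_ringHomComp q)
      (charTwist N (dvd_refl N) hqN (isQuadratic_quadraticChar_ringHomComp q) g) with hg2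
  have hcoef : ∀ n < B, cuspCoeff (g - g2) n = 0 := by
    intro n hn
    have h1 : cuspCoeff (g - g2) n = cuspCoeff g n - cuspCoeff g2 n := by
      rw [← cuspCoeffₗ_apply (one_mem_strictPeriods_coe_gamma0 N), ← cuspCoeffₗ_apply (one_mem_strictPeriods_coe_gamma0 N),
        ← cuspCoeffₗ_apply (one_mem_strictPeriods_coe_gamma0 N), map_sub]
    have h2 : cuspCoeff g2 n = (legendreSym q n : ℂ) * ((legendreSym q n : ℂ) * cuspCoeff g n) := by
      rw [hg2, cuspCoeff_charTwist N _ _ (isQuadratic_quadraticChar_ringHomComp q) hprim,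
        cuspCoeff_charTwist N _ _ (isQuadratic_quadraticChar_ringHomComp q) hprim, quadraticChar_ringHomComp_apply_natCast]
    rw [h1, h2]
    by_cases hqn : q ∣ n
    · rw [hzero n hn hqn, mul_zero, mul_zero, sub_zero]
    · have hsq : (legendreSym q n : ℂ) * (legendreSym q n : ℂ) = 1 := by
        have h := legendreSym.sq_one q (a := (n : ℤ)) (by
          intro h0
          exact hqn ((ZMod.natCast_eq_zero_iff n q).mp (by exact_mod_cast h0)))
        rw [sq] at h
        exact_mod_cast h
      rw [← mul_assoc, hsq, one_mul, sub_self]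
  have hzeroF : ModularFormClass.modularForm (g - g2) = 0 :=
    BracketSturm.modularForm_eq_zero_of_coeff_eq_zero (ModularFormClass.modularForm (g - g2)) (fun i hi ↦ hcoef i hi) hB
  have hcoe : (⇑(g - g2) : UpperHalfPlane → ℂ) = 0 := by
    have h := congrArg (fun F : ModularForm (Gamma0 N) 2 ↦ (⇑F : UpperHalfPlane → ℂ)) hzeroF
    simpa using h
  have hsub : g - g2 = 0 := DFunLike.ext' (hcoe.trans CuspForm.coe_zero.symm)
  exact sub_eq_zero.mp hsub

/-- **All coefficients**: under the same finite vanishing, `aₙ(g) = χ(n)·aₙ(g^χ)` for every `n`. [cite: Shimura1971, Prop. 3.64] -/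
theorem cuspCoeff_eq_chi_mul_charTwist {q : ℕ} [Fact q.Prime] (hq2 : q ≠ 2) {N : ℕ} [NeZero N] (hqN : q ^ 2 ∣ N)
    (g : CuspForm (Gamma0 N) 2) {B : ℕ} (hB : ((2 : ℤ) * gamma0Index N).toNat / 12 < B)
    (hzero : ∀ n < B, q ∣ n → cuspCoeff g n = 0) (n : ℕ) :
    cuspCoeff g n = (quadraticChar (ZMod q)).ringHomComp (Int.castRingHom ℂ) n *
      cuspCoeff (charTwist N (dvd_refl N) hqN (isQuadratic_quadraticChar_ringHomComp q) g) n := by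
  conv_lhs => rw [eq_charTwist_charTwist_of_cuspCoeff_eq_zero hq2 hqN g hB hzero]
  rw [cuspCoeff_charTwist N _ _ (isQuadratic_quadraticChar_ringHomComp q) (isPrimitive_quadraticChar_ringHomComp q hq2)]

/-! ## §3 Packaged for the level files -/

/-- **`|c| = 1` ON AN ALIGNED SAME-LEVEL TWIST ROW, from the squeeze of the datum-internal root form `(D.f)^χ`.**  `q` odd, `q² ∣ N`; `A` the
root curve (globally minimal, Néron pair `L_A`), `C = u • (A ⊗ ℚ(√q*))` globally minimal and ALIGNED (`Δ(C) = (q*)⁶Δ(A)`); `D` an `X₀(N)`-datum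
of a globally minimal `W` with the lattice clause, `aₙ(D.f) = 0` for `q ∣ n < B` (`B` past the weight-2 Sturm bound), and the analytic squeeze
`Λ((D.f)^χ) ⊆ Λ(L_A)` (a Bracket–Sturm certificate of the root class applied to the form `(D.f)^χ`).  Then `|c(D)| = 1`.
[cite: Pal2012, Lemma 3.1] [cite: Stevens1989, Lemma (5.4) p. 97] [cite: Sturm1987, Thm. 1] [cite: AgasheRibetStein2006, §§1–2] -/
theorem abs_maninConstant_eq_one_of_alignedTwist_of_squeeze {q : ℕ} [Fact q.Prime] (hq2 : q ≠ 2) {N : ℕ} [NeZero N] (hqN : q ^ 2 ∣ N)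
    (A : WeierstrassCurve ℚ) [A.IsElliptic] (LA : PeriodPair) (hLA : IsNeronLatticeOf (A.baseChange ℂ) LA)
    (C : WeierstrassCurve ℚ) [C.IsElliptic] [C.IsGloballyMinimal] (u : VariableChange ℚ)
    (hu : u • A.quadraticTwist (((-1 : ℤ) ^ (q / 2) * q : ℤ) : ℚ) = C)
    (hΔ : C.Δ = ((((-1 : ℤ) ^ (q / 2) * q : ℤ)) : ℚ) ^ 6 * A.Δ)
    (W : WeierstrassCurve ℚ) [W.IsElliptic] [W.IsGloballyMinimal] (D : ModularParametrizationData W N)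
    {B : ℕ} (hB : ((2 : ℤ) * gamma0Index N).toNat / 12 < B) (hzero : ∀ n < B, q ∣ n → cuspCoeff D.f n = 0)
    (hS0 : ∀ z ∈ periodLattice (charTwist N (dvd_refl N) hqN (isQuadratic_quadraticChar_ringHomComp q) D.f), z ∈ LA.lattice)
    (hopt : ∀ z ∈ D.L.lattice, ∃ w ∈ periodLattice D.f, z = D.c * w) :
    |D.maninConstant| = 1 :=
  abs_maninConstant_eq_one_of_rootForm_alignedTwist hq2 _ A LA hLA hS0 C u hu hΔ W D (dvd_refl N) hqN
    (cuspCoeff_eq_chi_mul_charTwist hq2 hqN D.f hB hzero) hopt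

end Summit.BirchSwinnertonDyer.BirchSwinnertonDyer.Theorems.ManinLocalTwoThree.SameLevelTwistRootForm

end
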